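import Summits.BirchSwinnertonDyer.BirchSwinnertonDyer.Theorems.ByReductionTypeAtTwoSupersingularFlatOrthogonalityReciprocity
import Summits.BirchSwinnertonDyer.BirchSwinnertonDyer.Theorems.ThetaPartnerAtTwoSignedKatoUpToAtTwoLayerPTOrthFinal
import Summits.BirchSwinnertonDyer.BirchSwinnertonDyer.Theorems.ThetaPartnerAtTwoSignedKatoUpToAtTwoLayerPairingLiterature
import HarnessLib

/-!
# Route `ByReductionTypeAtTwo` (rung K4), crux `SupersingularRankZeroAtTwo` (item stmt-BirchSwinnertonDyer-19097), line
# `odd_blind_package` v2.17/v2.18, stub `stub_flatPackage`, conjunct (8), clause F1♭ `Exact loc toX` — the half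
# «`range loc ⊆ ker toX`» (T-ORTH), PART 2: **(PT-orth) at a finite layer and level, EXACT, every prime `p`**:
# `⟨red_{p^{L₀}} x, p^{L₀} Q'⟩_{N, p^{L₀}} = 0` (cell `bsd-2adic`, seat `bsd-2adic-tower-1` GEN 68, hand hF1♭-ORTH;
# `--supports 19097`, helper)

HONEST FRAMING (D-0054): THEOREMS ONLY — no definition, no named fact, no instance, no `sorry`.  Helper toward conjunct (8);
closes NO stub; 19097 stays OPEN on its 5 registered stubs; nothing booked; BSD₂ is proved for no supersingular curve and BSD for
no curve by any of this; typed ≠ proved.  Generic prime `p`; NO `2 •` in any conclusion.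

## What and why

Sequel of `…FlatOrthogonalityReciprocity.lean` (the exact Poitou–Tate assembly `SSFlatPT.localInvariantMap_cup_shapiroLift_eq_zero`).
This file re-runs, WITHOUT the factor `2` and for every prime `p`, the remaining two steps of crux K3's (PT-orth) chain over `ℚ`:
* §1 the level transport for the Weil/Shapiro cup classes of a layer Selmer class and a class `x ∈ H¹(Γ_N, T_pE)` (twins of
  `LayerPTW2.two_nsmul_localInvariantMap_weilShapiroCup_eq_zero[_of_step]`, `htrans` discharged by
  `Kato2004.shapiroCup_weil_htrans_reduceH1Pk`, the archimedean input by `resOfLe_inf_decompInf_eq_zero_of_mem_selmerLayer`);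
* §2 the one-orbit identification at `v ∣ p` (`LayerPairing.invAt_localization_cupProduct_shapiroLift_layer`,
  `layerKummer_eq_oneCocycleClass`) — the exact twin of the registered K3 stub `LayerPTFinal.stub_ptOrthLayerTwo`, now for every
  `p`: for a layer Selmer class `t ∈ Sel_{p^∞}(E/ℚ_N)` with a cocycle `φ_N` killed by `p^{L₀}` whose restriction to
  `Gal(ℚ̄_v/ℚ_{N,v})` is the Kummer cocycle of `Q' ∈ E(ℚ̄_v)` (`p^{L₀} Q' ∈ E(ℚ_{N,v})`) and every `x ∈ H¹(Γ_N, T_pE)`,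
  `layerPairingPk … N L₀ x (p^{L₀} Q') = 0` for every tower-compatible Weil family, and
  `CyclotomicLayer.tatePairingPk W κ v N L₀ x (p^{L₀} Q') = 0` for THE Weil pairings — the currency of the residue clause of
  `SSFlatPackage.exists_linearMap_pairFun_tatePairing` (p830262) and of `SSFlatPT.exists_snd_coleman_apply_eq_of_levelwise` (p831689).

## What is proved
* `localInvariantMap_weilShapiroCup_eq_zero`, `localInvariantMap_weilShapiroCup_eq_zero_of_step` (§1);
* ★ `layerPairingPk_eq_zero_of_selmerLayer`, ★ `tatePairingPk_eq_zero_of_selmerLayer` (§2).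

References: [Kobayashi2003] (7.16)–(7.21) (p. 12), (8.23) (p. 18); [Kato2004Asterisque] §13.8 (p. 228), §17.13 (p. 279); [MilneADT2006]
Ch. I Thm. 4.10 (b), §6 proof of Prop. 6.9; [SilvermanAEC2009] Prop. III.8.1 (e), VIII §2; [NeukirchSchmidtWingberg2008] I §4 (1.4.2),
I §6 (1.6.4); [PerrinRiou1994Invent] §3.6.1.
-/

set_option autoImplicit false
-- the Theorems namespace of this sub repeats the summit name by design (D-0017 nested layout)
set_option linter.dupNamespace false

noncomputable section

open scoped Classical NumberField ContRepresentation

namespace Summit.BirchSwinnertonDyer.BirchSwinnertonDyer.Theorems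

namespace SSFlatPT

open CategoryTheory NumberField IsDedekindDomain Field ContinuousCohomology
  Literature.NumberTheory.EllipticCurves Literature.NumberTheory.EllipticCurves.GreenbergSelmer
  Literature.NumberTheory.EllipticCurves.Kato2004 Literature.NumberTheory.EllipticCurves.Kato2004.EulerSystemValues
  Literature.NumberTheory.GaloisRepresentations Literature.NumberTheory.GaloisRepresentations.DiscreteGaloisModule
  Literature.NumberTheory.GaloisCohomology ZpExtension
open WeierstrassCurve (geomPoints geomTorsion)
open Literature.NumberTheory.EllipticCurves.Kobayashi2003 Literature.NumberTheory.EllipticCurves.Sprung2012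

variable (W : WeierstrassCurve ℚ) [W.IsElliptic] {p : ℕ} [hp : Fact p.Prime] [ContinuousSMul ℤ_[p] (W.tateModule p)]
  (κ : ZpExtension ℚ p) (N : ℕ)
  {s : absoluteGaloisGroup ℚ ⧸ κ.layerSubgroup N → absoluteGaloisGroup ℚ}
  (hs : ∀ x, (s x : absoluteGaloisGroup ℚ ⧸ κ.layerSubgroup N) = x)
  (hs1 : s ((1 : absoluteGaloisGroup ℚ) : absoluteGaloisGroup ℚ ⧸ κ.layerSubgroup N) = 1)

/-! ## §1 Poitou–Tate for the Weil/Shapiro cup classes over `ℚ`, EXACT (twins of `LayerPTW2.…` without `2 •`) -/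

/-- **Poitou–Tate for the Weil/Shapiro cup classes of a layer Selmer class and a class of `H¹(Γ_N, T_pE)`, over `ℚ`, EXACT.**
For `t ∈ Sel_{p^∞}(E/ℚ_N)` with cocycle `φ_N`, finite-level lifts `ψ_L : Γ_N → E[p^L]` of `φ_N` (`L ≥ L₀`), a tower-compatible family of
`Γ_ℚ`-equivariant biadditive pairings `e_L : E[p^L] × E[p^L] → μ_{p^L}` (`hcompat`), re-typings `r_L` (identity on points),
`x ∈ H¹(Γ_N, T_pE)`, and the place `v₀` with every other finite place prime to `p`:
`inv_{v₀}( loc_{v₀}( Sh_{Γ_N}((r_{L₀})_* red_{p^{L₀}} x) ∪_{Σ e_{L₀}} Sh_{Γ_N}[ψ_{L₀}] ) ) = 0` — NO factor `2`: the exact assembly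
`localInvariantMap_cup_shapiroLift_eq_zero`, its archimedean input from `resOfLe_inf_decompInf_eq_zero_of_mem_selmerLayer`, its `htrans`
from `Kato2004.shapiroCup_weil_htrans_reduceH1Pk` (the exact twin of `LayerPTW2.two_nsmul_localInvariantMap_weilShapiroCup_eq_zero`).
[cite: Kobayashi2003, (7.16)–(7.21) (p. 12)] [cite: MilneADT2006, Ch. I, Thm. 4.10(b)] [cite: SilvermanAEC2009, Prop. III.8.1(e)] -/
theorem localInvariantMap_weilShapiroCup_eq_zero [Fintype (absoluteGaloisGroup ℚ ⧸ κ.layerSubgroup N)]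
    (v₀ : HeightOneSpectrum (𝓞 ℚ)) (hv₀ : ∀ v : HeightOneSpectrum (𝓞 ℚ), v ≠ v₀ → ((p : ℕ) : 𝓞 ℚ) ∉ v.asIdeal)
    {t : W.subgroupH1 p (κ.layerSubgroup N)} (ht : t ∈ W.selmerLayer κ N)
    (φN : contOneCocycles (discreteTopRep (κ.layerSubgroup N) (W.geomPrimaryTorsion p))) (hφN : oneCocycleClass _ φN = t)
    (L₀ : ℕ)
    (ψ : ∀ L : ℕ, L₀ ≤ L →
      contOneCocycles (subgroupRep (W.torsionGaloisModule ((p ^ L : ℕ) : ℤ)).toTopRep (κ.layerSubgroup N)))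
    (hψ : ∀ (L : ℕ) (hL : L₀ ≤ L) (y : κ.layerSubgroup N),
      (((ψ L hL).1 y : geomTorsion W ((p ^ L : ℕ) : ℤ)) : W.geomPoints) = ((φN.1 y : W.geomPrimaryTorsion p) : W.geomPoints))
    (e : ∀ L : ℕ, geomTorsion W ((p ^ L : ℕ) : ℤ) → geomTorsion W ((p ^ L : ℕ) : ℤ) → AlgebraicClosure ℚ)
    (hμ : ∀ (L : ℕ) S T, e L S T ^ (p ^ L) = 1)
    (hadd₁ : ∀ (L : ℕ) S₁ S₂ T, e L (S₁ + S₂) T = e L S₁ T * e L S₂ T)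
    (hadd₂ : ∀ (L : ℕ) S T₁ T₂, e L S (T₁ + T₂) = e L S T₁ * e L S T₂)
    (hgal : ∀ (L : ℕ) (σ : absoluteGaloisGroup ℚ) S T, σ • e L S T = e L (σ • S) (σ • T))
    (hcompat : ∀ (L : ℕ) (_ : L₀ ≤ L)
      (α : (W.torsionGaloisModule ((p ^ L : ℕ) : ℤ)).toContRepresentation →ⁱL
        (W.torsionGaloisModule ((p ^ L₀ : ℕ) : ℤ)).toContRepresentation)
      (β : (W.torsionGaloisModule ((p ^ L₀ : ℕ) : ℤ)).toContRepresentation →ⁱL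
        (W.torsionGaloisModule ((p ^ L : ℕ) : ℤ)).toContRepresentation),
      (∀ S, ((α S : geomTorsion W ((p ^ L₀ : ℕ) : ℤ)) : geomPoints W) = (p : ℤ) ^ (L - L₀) • (S : geomPoints W)) →
      (∀ T, ((β T : geomTorsion W ((p ^ L : ℕ) : ℤ)) : geomPoints W) = (T : geomPoints W)) →
      ∀ (S' : geomTorsion W ((p ^ L : ℕ) : ℤ)) (T : geomTorsion W ((p ^ L₀ : ℕ) : ℤ)), e L S' (β T) = e L₀ (α S') T)
    (r : ∀ L : ℕ, geomTorsion W ((p : ℤ) ^ L) →+ geomTorsion W ((p ^ L : ℕ) : ℤ))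
    (hrc : ∀ L : ℕ, Continuous (r L))
    (hrρ : ∀ (L : ℕ) (u : κ.layerSubgroup N) (P : geomTorsion W ((p : ℤ) ^ L)),
      r L ((subgroupRep (W.torsionGaloisModule ((p : ℤ) ^ L)).toTopRep (κ.layerSubgroup N)).ρ u P) =
        (subgroupRep (W.torsionGaloisModule ((p ^ L : ℕ) : ℤ)).toTopRep (κ.layerSubgroup N)).ρ u (r L P))
    (hr : ∀ (L : ℕ) (P : geomTorsion W ((p : ℤ) ^ L)), ((r L P : geomTorsion W ((p ^ L : ℕ) : ℤ)) : geomPoints W) = P)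
    (x : H1 (tateRep W p) (κ.layerSubgroup N)) :
    haveI : CompactSpace (absoluteGaloisGroup ℚ) := absoluteGaloisGroup_compactSpace ℚ
    localInvariantMap ℚ (p ^ L₀) v₀ (galoisCohomology.localization (mu ℚ (p ^ L₀)) (Sum.inr v₀) 2
      (((weilContPairing W (p ^ L₀) (e L₀) (hμ L₀) (hadd₁ L₀) (hadd₂ L₀) (hgal L₀)).coindFin (κ.layerSubgroup N)).cupProduct
        (shapiroLift (W.torsionGaloisModule ((p ^ L₀ : ℕ) : ℤ)).toTopRep (κ.layerSubgroup N) (κ.isOpen_layerSubgroup N) hs hs1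
          (mapH1AddHom (subgroupRep (W.torsionGaloisModule ((p : ℤ) ^ L₀)).toTopRep (κ.layerSubgroup N))
            (subgroupRep (W.torsionGaloisModule ((p ^ L₀ : ℕ) : ℤ)).toTopRep (κ.layerSubgroup N)) (r L₀) (hrc L₀) (hrρ L₀)
            (reduceH1Pk W p L₀ (κ.layerSubgroup N) x)))
        (shapiroLift (W.torsionGaloisModule ((p ^ L₀ : ℕ) : ℤ)).toTopRep (κ.layerSubgroup N) (κ.isOpen_layerSubgroup N) hs hs1
          (oneCocycleClass _ (ψ L₀ le_rfl))))) = 0 := by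
  haveI : CompactSpace (absoluteGaloisGroup ℚ) := absoluteGaloisGroup_compactSpace ℚ
  exact localInvariantMap_cup_shapiroLift_eq_zero W κ N hs hs1 v₀ hv₀ ht
    (fun w σ ↦ resOfLe_inf_decompInf_eq_zero_of_mem_selmerLayer W κ w N ht σ) φN hφN L₀ ψ hψ
    (fun L _ ↦ coindFin (W.torsionGaloisModule ((p ^ L : ℕ) : ℤ)).toTopRep (κ.layerSubgroup N))
    (fun L _ ↦ (weilContPairing W (p ^ L) (e L) (hμ L) (hadd₁ L) (hadd₂ L) (hgal L)).coindFin (κ.layerSubgroup N))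
    (fun L _ ↦ shapiroLift (W.torsionGaloisModule ((p ^ L : ℕ) : ℤ)).toTopRep (κ.layerSubgroup N)
      (κ.isOpen_layerSubgroup N) hs hs1
      (mapH1AddHom (subgroupRep (W.torsionGaloisModule ((p : ℤ) ^ L)).toTopRep (κ.layerSubgroup N))
        (subgroupRep (W.torsionGaloisModule ((p ^ L : ℕ) : ℤ)).toTopRep (κ.layerSubgroup N)) (r L) (hrc L) (hrρ L)
        (reduceH1Pk W p L (κ.layerSubgroup N) x)))
    (fun L hL ↦ shapiroCup_weil_htrans_reduceH1Pk W (κ.layerSubgroup N) (κ.isOpen_layerSubgroup N) hs hs1 L₀ e hμ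
      hadd₁ hadd₂ hgal hcompat ψ (fun L' hL' y ↦ (hψ L' hL' y).trans (hψ L₀ le_rfl y).symm) r hrc hrρ hr x L hL)

/-- **The same, fed with the data of a Weil FAMILY with the ONE-STEP compatibility** (WEIL) «`e (k+1) S' T' = e k S T` when `S = p S'`,
`T' = T` on points», at the place `v ∋ p` of `ℚ`, for a layer Selmer class `t` with a cocycle `φ_N` KILLED BY `p^{L₀}` and ONE lift
`ψ₀ : Γ_N → E[p^{L₀}]` of `φ_N`: `inv_v( loc_v( Sh_{Γ_N}(red_{p^{L₀}} x) ∪_{Σ e_{L₀}} Sh_{Γ_N}[ψ₀] ) ) = 0` — NO factor `2` (the exact twin of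
`LayerPTW2.two_nsmul_localInvariantMap_weilShapiroCup_eq_zero_of_step`; same proof with §1's exact assembly).
[cite: Kobayashi2003, (7.16)–(7.21) (p. 12)] [cite: MilneADT2006, Ch. I, Thm. 4.10(b)] [cite: SilvermanAEC2009, Prop. III.8.1(e)] -/
theorem localInvariantMap_weilShapiroCup_eq_zero_of_step [Fintype (absoluteGaloisGroup ℚ ⧸ κ.layerSubgroup N)]
    (v : HeightOneSpectrum (𝓞 ℚ)) (hv : ((p : ℕ) : 𝓞 ℚ) ∈ v.asIdeal)
    (e : ∀ k : ℕ, geomTorsion W ((p ^ k : ℕ) : ℤ) → geomTorsion W ((p ^ k : ℕ) : ℤ) → AlgebraicClosure ℚ)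
    (hμ : ∀ (k : ℕ) S T, e k S T ^ (p ^ k) = 1)
    (hadd₁ : ∀ (k : ℕ) S₁ S₂ T, e k (S₁ + S₂) T = e k S₁ T * e k S₂ T)
    (hadd₂ : ∀ (k : ℕ) S T₁ T₂, e k S (T₁ + T₂) = e k S T₁ * e k S T₂)
    (hgal : ∀ (k : ℕ) (σ : absoluteGaloisGroup ℚ) S T, σ • e k S T = e k (σ • S) (σ • T))
    (hstep : ∀ (k : ℕ) (S' : geomTorsion W ((p ^ (k + 1) : ℕ) : ℤ)) (S : geomTorsion W ((p ^ k : ℕ) : ℤ))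
      (T' : geomTorsion W ((p ^ (k + 1) : ℕ) : ℤ)) (T : geomTorsion W ((p ^ k : ℕ) : ℤ)),
      (S : W.geomPoints) = (p : ℤ) • (S' : W.geomPoints) → (T' : W.geomPoints) = (T : W.geomPoints) →
      e (k + 1) S' T' = e k S T)
    (L₀ : ℕ) (x : H1 (tateRep W p) (κ.layerSubgroup N))
    {t : W.subgroupH1 p (κ.layerSubgroup N)} (ht : t ∈ W.selmerLayer κ N)
    (φN : contOneCocycles (discreteTopRep (κ.layerSubgroup N) (W.geomPrimaryTorsion p))) (hφN : oneCocycleClass _ φN = t)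
    (hkill : ∀ y : κ.layerSubgroup N, (p ^ L₀ : ℕ) • ((φN.1 y : W.geomPrimaryTorsion p) : W.geomPoints) = 0)
    (ψ₀ : contOneCocycles (subgroupRep (W.torsionGaloisModule ((p ^ L₀ : ℕ) : ℤ)).toTopRep (κ.layerSubgroup N)))
    (hψ₀ : ∀ y : κ.layerSubgroup N,
      ((ψ₀.1 y : geomTorsion W ((p ^ L₀ : ℕ) : ℤ)) : W.geomPoints) = ((φN.1 y : W.geomPrimaryTorsion p) : W.geomPoints)) :
    haveI : CompactSpace (absoluteGaloisGroup ℚ) := absoluteGaloisGroup_compactSpace ℚ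
    localInvariantMap ℚ (p ^ L₀) v (galoisCohomology.localization (mu ℚ (p ^ L₀)) (Sum.inr v) 2
      (((weilContPairing W (p ^ L₀) (e L₀) (hμ L₀) (hadd₁ L₀) (hadd₂ L₀) (hgal L₀)).coindFin (κ.layerSubgroup N)).cupProduct
        (shapiroLift (W.torsionGaloisModule ((p ^ L₀ : ℕ) : ℤ)).toTopRep (κ.layerSubgroup N) (κ.isOpen_layerSubgroup N) hs hs1
          (reduceH1Pk W p L₀ (κ.layerSubgroup N) x))
        (shapiroLift (W.torsionGaloisModule ((p ^ L₀ : ℕ) : ℤ)).toTopRep (κ.layerSubgroup N) (κ.isOpen_layerSubgroup N) hs hs1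
          (oneCocycleClass _ ψ₀)))) = 0 := by
  haveI : CompactSpace (absoluteGaloisGroup ℚ) := absoluteGaloisGroup_compactSpace ℚ
  -- (1) the other finite places of `ℚ` are prime to `p`
  have hv₀ : ∀ w : HeightOneSpectrum (𝓞 ℚ), w ≠ v → ((p : ℕ) : 𝓞 ℚ) ∉ w.asIdeal := fun w hw hpw ↦
    hw (((natCast_mem_asIdeal_iff_eq_primesEquiv_symm w hp.out).mp hpw).trans
      ((natCast_mem_asIdeal_iff_eq_primesEquiv_symm v hp.out).mp hv).symm)
  -- (2) finite-level lifts of `φ_N` at every level `L ≥ L₀`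
  have hlift : ∀ L : ℕ, L₀ ≤ L →
      ∃ ψ : contOneCocycles (subgroupRep (W.torsionGaloisModule ((p ^ L : ℕ) : ℤ)).toTopRep (κ.layerSubgroup N)),
        ∀ y, ((ψ.1 y : geomTorsion W ((p ^ L : ℕ) : ℤ)) : W.geomPoints) =
          ((φN.1 y : W.geomPrimaryTorsion p) : W.geomPoints) := fun L hL ↦
    SignedKatoOffTwo.LayerFinite.exists_torsionCocycle_of_zsmul_eq_zero W p (κ.layerSubgroup N) ((p ^ L : ℕ) : ℤ) φN fun y ↦ by
      obtain ⟨j, rfl⟩ := Nat.exists_eq_add_of_le hL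
      rw [natCast_zsmul, pow_add, mul_comm, mul_smul, hkill, smul_zero]
  choose ψ hψ using hlift
  -- (3) the re-typings `E[(p:ℤ)^L] ⊆ E[((p^L:ℕ):ℤ)]`
  have hle : ∀ L : ℕ, geomTorsion W ((p : ℤ) ^ L) ≤ geomTorsion W ((p ^ L : ℕ) : ℤ) := fun L ↦
    W.geomTorsion_le_of_dvd (by rw [Nat.cast_pow])
  -- (4) the assembled statement
  have hmain := localInvariantMap_weilShapiroCup_eq_zero W κ N hs hs1 v hv₀ ht φN hφN L₀ ψ hψ e hμ hadd₁
    hadd₂ hgal (fun L hL α β hα hβ ↦ weilFamily_hcompat_of_step W e hstep L₀ L hL α β hα hβ)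
    (fun L ↦ AddSubgroup.inclusion (hle L)) (fun L ↦ continuous_of_discreteTopology)
    (fun L ↦ coeMap_subgroupRep W (AddSubgroup.inclusion (hle L)) (fun _ ↦ rfl) (κ.layerSubgroup N)) (fun L P ↦ rfl) x
  -- (5) the re-typed reduction IS the reduction, and `[ψ L₀] = [ψ₀]`
  have h1 : mapH1AddHom (subgroupRep (W.torsionGaloisModule ((p : ℤ) ^ L₀)).toTopRep (κ.layerSubgroup N))
      (subgroupRep (W.torsionGaloisModule ((p ^ L₀ : ℕ) : ℤ)).toTopRep (κ.layerSubgroup N))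
      (AddSubgroup.inclusion (hle L₀)) continuous_of_discreteTopology
      (coeMap_subgroupRep W (AddSubgroup.inclusion (hle L₀)) (fun _ ↦ rfl) (κ.layerSubgroup N))
      (reduceH1Pk W p L₀ (κ.layerSubgroup N) x) =
      (reduceH1Pk W p L₀ (κ.layerSubgroup N) x :
        continuousCohomology 1 (subgroupRep (W.torsionGaloisModule ((p ^ L₀ : ℕ) : ℤ)).toTopRep (κ.layerSubgroup N))) := by
    obtain ⟨φ, rfl⟩ := oneCocycleClass_surjective _ x
    rw [reduceH1Pk_oneCocycleClass, mapH1AddHom_oneCocycleClass]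
    exact congrArg _ (Subtype.ext (ContinuousMap.ext fun _ ↦ rfl))
  have h2 : oneCocycleClass _ (ψ L₀ le_rfl) = oneCocycleClass _ ψ₀ :=
    congrArg _ (Subtype.ext (ContinuousMap.ext fun y ↦ Subtype.ext ((hψ L₀ le_rfl y).trans (hψ₀ y).symm)))
  rw [h1, h2] at hmain
  exact hmain

/-! ## §2 (PT-orth) at a finite layer and level, EXACT, every prime `p` (twin of `LayerPTFinal.stub_ptOrthLayerTwo` without
the factor `2`): `⟨red_{p^{L₀}} x, p^{L₀} Q'⟩_{N, p^{L₀}} = 0` -/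

/-- ★ **(PT-orth) at a finite layer and level, EXACT, every prime `p`** — the registered K3 stub `LayerPTFinal.stub_ptOrthLayerTwo` with
the factor `2` REMOVED and `2` replaced by any prime: for the cyclotomic `ℤ_p`-extension `κ` of `ℚ`, the place `v ∋ p`, every
tower-compatible `Γ_ℚ`-equivariant biadditive Weil family `e_k : E[p^k] × E[p^k] → μ_{p^k}` (one-step compatibility `hstep`), layer `N`,
level `L₀`, `x ∈ H¹(Γ_N, T_pE)`, every layer Selmer class `t ∈ Sel_{p^∞}(E/ℚ_N)` with a cocycle `φ_N` killed by `p^{L₀}` whose restriction to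
`U_N = Gal(ℚ̄_v/ℚ_{N,v})` is the Kummer cocycle of `Q' ∈ E(ℚ̄_v)` with `p^{L₀} Q' ∈ E(ℚ_{N,v})`:
`⟨red_{p^{L₀}} x, p^{L₀} Q'⟩_{N, p^{L₀}} = 0` (`LayerPairing.layerPairingPk`).  Proof: one finite-level lift
(`LayerFinite.exists_torsionCocycle_of_zsmul_eq_zero`), the exact Poitou–Tate `localInvariantMap_weilShapiroCup_eq_zero_of_step`, one orbit
at `v ∣ p` (`LayerPairing.invAt_localization_cupProduct_shapiroLift_layer`, `layerKummer_eq_oneCocycleClass`).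
[cite: Kobayashi2003, (7.16)–(7.21) (p. 12), (8.23) (p. 18)] [cite: Kato2004Asterisque, §17.13 (p. 279)] [cite: MilneADT2006, Ch. I, Thm. 4.10(b)] -/
theorem layerPairingPk_eq_zero_of_selmerLayer (hκ : κ.IsCyclotomic) (v : HeightOneSpectrum (𝓞 ℚ)) (hv : (p : 𝓞 ℚ) ∈ v.asIdeal)
    (ePk : ∀ k : ℕ, geomTorsion W (p ^ k) → geomTorsion W (p ^ k) → AlgebraicClosure ℚ)
    (hμ : ∀ k S T, ePk k S T ^ (p ^ k) = 1)
    (hadd₁ : ∀ k S₁ S₂ T, ePk k (S₁ + S₂) T = ePk k S₁ T * ePk k S₂ T)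
    (hadd₂ : ∀ k S T₁ T₂, ePk k S (T₁ + T₂) = ePk k S T₁ * ePk k S T₂)
    (hgal : ∀ k (σ : absoluteGaloisGroup ℚ) (S T : geomTorsion W (p ^ k)), σ • ePk k S T = ePk k (σ • S) (σ • T))
    (hstep : ∀ (k : ℕ) (S' : geomTorsion W (p ^ (k + 1))) (S : geomTorsion W (p ^ k))
      (T' : geomTorsion W (p ^ (k + 1))) (T : geomTorsion W (p ^ k)),
      (S : W.geomPoints) = (p : ℤ) • (S' : W.geomPoints) → (T' : W.geomPoints) = (T : W.geomPoints) →
      ePk (k + 1) S' T' = ePk k S T)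
    (L₀ : ℕ) (x : H1 (tateRep W p) (κ.layerSubgroup N))
    {t : W.subgroupH1 p (κ.layerSubgroup N)} (ht : t ∈ W.selmerLayer κ N)
    (φN : contOneCocycles (discreteTopRep (κ.layerSubgroup N) (W.geomPrimaryTorsion p))) (hφN : oneCocycleClass _ φN = t)
    (hkill : ∀ y : κ.layerSubgroup N, (p ^ L₀ : ℕ) • ((φN.1 y : W.geomPrimaryTorsion p) : W.geomPoints) = 0)
    (Q' : localPoints W (v.adicCompletion ℚ))
    (hP' : (p ^ L₀ : ℕ) • Q' ∈ localLayerPointsOfEmb κ (closureEmb (K := ℚ) (v.adicCompletion ℚ)) W N)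
    (hKum : ∀ τ : localSubgroupOfEmb (κ.layerSubgroup N) (closureEmb (K := ℚ) (v.adicCompletion ℚ)),
      pointsMapOfEmb W (closureEmb (K := ℚ) (v.adicCompletion ℚ))
          ((φN.1 (resGalSubgroupOfEmb (κ.layerSubgroup N) _ τ) : W.geomPrimaryTorsion p) : W.geomPoints) =
        (τ : absoluteGaloisGroup (v.adicCompletion ℚ)) • Q' - Q') :
    SignedKatoOffTwo.LayerPairing.layerPairingPk W κ v ePk hμ hadd₁ hadd₂ hgal N L₀ x ⟨(p ^ L₀ : ℕ) • Q', hP'⟩ = 0 := by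
  haveI : CompactSpace (absoluteGaloisGroup ℚ) := absoluteGaloisGroup_compactSpace ℚ
  haveI : (κ.layerSubgroup N).FiniteIndex := finiteIndex_of_isOpen_of_compactSpace _ (κ.isOpen_layerSubgroup N)
  haveI : Fintype (absoluteGaloisGroup ℚ ⧸ κ.layerSubgroup N) := Fintype.ofFinite _
  obtain ⟨s, hs, hs1⟩ := exists_reps_one (κ.layerSubgroup N)
  -- (1) one finite-level lift `ψ₀ : Γ_N → E[p^{L₀}]` of `φ_N`
  obtain ⟨ψ₀, hψ₀⟩ := SignedKatoOffTwo.LayerFinite.exists_torsionCocycle_of_zsmul_eq_zero W p (κ.layerSubgroup N)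
    ((p ^ L₀ : ℕ) : ℤ) φN (fun y ↦ by rw [natCast_zsmul]; exact hkill y)
  -- (2) exact Poitou–Tate for the Weil/Shapiro cup class
  have hPT := localInvariantMap_weilShapiroCup_eq_zero_of_step W κ N hs hs1 v hv ePk hμ hadd₁ hadd₂ hgal hstep L₀ x ht
    φN hφN hkill ψ₀ hψ₀
  -- (3) one orbit at `v ∣ p`: the local term IS the layer pairing value, via the layer Kummer class of `p^{L₀} Q'`
  have hb : SignedKatoOffTwo.LayerPairing.layerLoc W (p ^ L₀) κ v N (oneCocycleClass _ ψ₀) =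
      SignedKatoOffTwo.LayerPairing.layerKummer W (p ^ L₀) κ v N ⟨(p ^ L₀ : ℕ) • Q', hP'⟩ := by
    symm
    rw [SignedKatoOffTwo.LayerPairing.layerLoc, map_oneCocycleClass]
    refine SignedKatoOffTwo.LayerPairing.layerKummer_eq_oneCocycleClass W (p ^ L₀) κ v N ⟨(p ^ L₀ : ℕ) • Q', hP'⟩ Q'
      (natCast_zsmul _ _) _ fun τ ↦ ?_
    have e1 := hψ₀ (resGalSubgroupOfEmb (κ.layerSubgroup N) (closureEmb (K := ℚ) (v.adicCompletion ℚ)) τ)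
    rw [← hKum τ, ← e1]
    rfl
  have hT3 := SignedKatoOffTwo.LayerPairing.invAt_localization_cupProduct_shapiroLift_layer W (p ^ L₀) (ePk L₀) (hμ L₀)
    (hadd₁ L₀) (hadd₂ L₀) (hgal L₀) κ v hκ hv N hs hs1 (reduceH1Pk W p L₀ (κ.layerSubgroup N) x)
    (oneCocycleClass _ ψ₀) ⟨(p ^ L₀ : ℕ) • Q', hP'⟩ hb
  rw [SignedKatoOffTwo.LayerPairing.layerPairingPk_apply, ← hT3]
  exact hPT

/-- ★ **(PT-orth) at a finite layer and level for THE Weil pairings, in the currency of the residue clause**: under the hypotheses of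
`layerPairingPk_eq_zero_of_selmerLayer` (THE Weil tower `CyclotomicLayer.weilTowerPk`, one-step compatible by
`CyclotomicLayer.weilTowerPk_succ_of_coe_eq`), `CyclotomicLayer.tatePairingPk W κ v N L₀ x (p^{L₀} Q') = 0` — every prime `p`, no factor `2`.
[cite: Kobayashi2003, (8.23) (p. 18)] [cite: PerrinRiou1994Invent, §3.6.1] [cite: Kato2004Asterisque, §17.13 (p. 279)] -/
theorem tatePairingPk_eq_zero_of_selmerLayer (hκ : κ.IsCyclotomic) (v : HeightOneSpectrum (𝓞 ℚ)) (hv : (p : 𝓞 ℚ) ∈ v.asIdeal)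
    (L₀ : ℕ) (x : H1 (tateRep W p) (κ.layerSubgroup N))
    {t : W.subgroupH1 p (κ.layerSubgroup N)} (ht : t ∈ W.selmerLayer κ N)
    (φN : contOneCocycles (discreteTopRep (κ.layerSubgroup N) (W.geomPrimaryTorsion p))) (hφN : oneCocycleClass _ φN = t)
    (hkill : ∀ y : κ.layerSubgroup N, (p ^ L₀ : ℕ) • ((φN.1 y : W.geomPrimaryTorsion p) : W.geomPoints) = 0)
    (Q' : localPoints W (v.adicCompletion ℚ))
    (hP' : (p ^ L₀ : ℕ) • Q' ∈ localLayerPointsOfEmb κ (closureEmb (K := ℚ) (v.adicCompletion ℚ)) W N)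
    (hKum : ∀ τ : localSubgroupOfEmb (κ.layerSubgroup N) (closureEmb (K := ℚ) (v.adicCompletion ℚ)),
      pointsMapOfEmb W (closureEmb (K := ℚ) (v.adicCompletion ℚ))
          ((φN.1 (resGalSubgroupOfEmb (κ.layerSubgroup N) _ τ) : W.geomPrimaryTorsion p) : W.geomPoints) =
        (τ : absoluteGaloisGroup (v.adicCompletion ℚ)) • Q' - Q') :
    CyclotomicLayer.tatePairingPk W κ v N L₀ x ⟨(p ^ L₀ : ℕ) • Q', hP'⟩ = 0 := by
  have h := layerPairingPk_eq_zero_of_selmerLayer W κ N hκ v hv (CyclotomicLayer.weilTowerPk W) (CyclotomicLayer.weilTowerPk_pow W)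
    (CyclotomicLayer.weilTowerPk_add_left W) (CyclotomicLayer.weilTowerPk_add_right W) (CyclotomicLayer.weilTowerPk_smul W)
    (CyclotomicLayer.weilTowerPk_succ_of_coe_eq W) L₀ x ht φN hφN hkill Q' hP' hKum
  rw [CyclotomicLayer.tatePairingPk_eq]
  exact h

end SSFlatPT

end Summit.BirchSwinnertonDyer.BirchSwinnertonDyer.Theorems

end
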